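import Summits.BirchSwinnertonDyer.BirchSwinnertonDyer.Theorems.ByReductionTypeAtTwoMultTowerNS2OrderBound
import HarnessLib

/-!
# Route `ByReductionTypeAtTwo`, crux `MultUpperHalfAtTwo` (item stmt-BirchSwinnertonDyer-19922), TOWER road, NON-SPLIT rows:
# the layer-`0` order of the local tower kernel at a non-split `2`, part 6 — norm formulas for the three fields
# `F_n = K̄_v^{H_n}`, `M = K̄_v^{Stab t} = ℚ_v(t)` and the cyclic layer `F'_n = K̄_v^{H_n ∩ Stab t}` over `M`

HONEST FRAMING (cell `bsd-2adic`, run/shared/lean/pub/bsd-2adic/, seat `bsd-2adic-tower-1` GEN 30, HUMAN RULINGS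
D-0036 / D-0054 / D-0074): TOOL theorems only (no definition, no named fact, no `sorry`); closes nothing by itself;
nothing booked; BSD is not proved by any of this. Sixth brick of the layer-`0` count `#𝒦_{v,0}[2^∞] = 2·c₂^{(2)}` at a
non-split multiplicative `2` (R. Greenberg, LNM 1716, §3 p. 93 / §4 p. 113; scope memo
`tower/SCOPE-NS2-LAYER0-EXACT-GEN29.md` (L1)/(L2)): the inputs of the RELATIVE NORM EXISTENCE for the cyclic layers
`F'_n/M` (part 7, `exists_prod_smul_eq_of_norm_mem_range_norm_layer`), which produces the lower-bound witnesses.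
Setting: `v ∋ 2`, `κ` cyclotomic, `H_n` the local layer subgroups, `t ≠ 0` with `σt = ±t`, a flip `τ₀` (`τ₀t = −t`), a
generator `g` at the layer `0` (`κ(res g)` a unit) fixing `t`.

* `exists_mem_range_norm_layer_val_eq_two` — `2 ∈ N_{F_n/ℚ_v}(F_nˣ)` (`n ≥ 1`; BRICK 13b: `2 = N(2 + y_n)`);
* `algebraMap_norm_layer_eq_prod_pow_smul` — `N_{F_n/ℚ_v}(ℓ) = ∏_{i<2^n} gⁱℓ` (the `gⁱ` represent `Γ/H_n`, BRICKs 15/16);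
* `algebraMap_norm_stabilizer_eq_mul_smul` — `N_{M/ℚ_v}(k) = k·τ₀k` (`[M : ℚ_v] = 2`, `Gal = {1, τ₀|}`);
* `index_range_norm_relLayer_eq_and_norm_eq_prod_smul` — **`F'_n/M` is cyclic of degree `2^n` generated by `g|`**
  (`gⁱ ∈ H_n ⟺ 2^n ∣ i`): `[Mˣ : N(F'_nˣ)] = 2^n` (the tree's PROVED class field axiom
  `normIndex_eq_finrank_of_isNonarchimedeanLocalField`, Neukirch V (1.1)) and `N_{F'_n/M}(f) = ∏_{i<2^n} gⁱf`.

Lean note: `absoluteGaloisGroup ℚ_v` is a `def` over `K̄_v ≃ₐ[ℚ_v] K̄_v`, so statements about `fixedField` of local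
subgroups are consumed by `exact`/`trans` (definitional unfolding), never by `rw`.

References: J. Neukirch, *ANT* IV §1, V §1 Thm. (1.1); L. Washington, *Cyclotomic Fields*, §13.1, Prop. 2.16;
R. Greenberg, LNM 1716 (1999), §3 p. 93.
-/

set_option autoImplicit false
-- the Theorems namespace of this sub repeats the summit name by design (D-0017 nested layout: Summit.<S>.<Sub>)
set_option linter.dupNamespace false

noncomputable section

open scoped Classical IntermediateField

namespace Summit.BirchSwinnertonDyer.BirchSwinnertonDyer.Theorems.MultTowerNS2LayerZero

open NumberField IsDedekindDomain Field PadicInt Literature.NumberTheory.EllipticCurves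
  Literature.NumberTheory.GaloisRepresentations Summit.BirchSwinnertonDyer.BirchSwinnertonDyer.Theorems.MultTowerNS2

variable {κ : ZpExtension ℚ 2}

/-! ### The cyclotomic layer `F_n = K̄^{H_n}`: `2 ∈ N(F_nˣ)` and the norm as an orbit product of a layer-`0` generator -/

/-- **`2` is a norm from every layer `F_n` (`n ≥ 1`)** — `2 = N_{F_n/ℚ_v}(2 + y_n)`, `y_n = ζ_{2^{n+2}} + ζ⁻¹` (BRICK 13b
`norm_one_add_eq_and_norm_two_add_eq`), packaged as a unit of `ℚ_v` in the norm group. [cite: Washington1997, Prop. 2.16] -/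
theorem exists_mem_range_norm_layer_val_eq_two (hκ : κ.IsCyclotomic) (v : HeightOneSpectrum (𝓞 ℚ))
    (hv : ((2 : ℕ) : 𝓞 ℚ) ∈ v.asIdeal) {n : ℕ} (hn : 1 ≤ n) :
    ∃ u2 : (v.adicCompletion ℚ)ˣ,
      u2 ∈ (Units.map (Algebra.norm (v.adicCompletion ℚ) :
        IntermediateField.fixedField (localSubgroup (κ.layerSubgroup n) (v.adicCompletion ℚ)) →*
          v.adicCompletion ℚ)).range ∧ (u2 : v.adicCompletion ℚ) = 2 := by
  set F := IntermediateField.fixedField (localSubgroup (κ.layerSubgroup n) (v.adicCompletion ℚ)) with hF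
  haveI := finiteDimensional_fixedField_localSubgroup_layerSubgroup (κ := κ) v n
  haveI : CharZero (v.adicCompletion ℚ) :=
    charZero_of_injective_algebraMap (algebraMap ℚ (v.adicCompletion ℚ)).injective
  obtain ⟨ζ, hζ⟩ : ∃ ζ : AlgebraicClosure (v.adicCompletion ℚ), IsPrimitiveRoot ζ (2 ^ (n + 2)) := by
    haveI : NeZero ((2 ^ (n + 2) : ℕ) : AlgebraicClosure (v.adicCompletion ℚ)) :=
      ⟨by rw [Nat.cast_pow]; exact pow_ne_zero _ (by norm_num)⟩
    exact HasEnoughRootsOfUnity.exists_primitiveRoot (AlgebraicClosure (v.adicCompletion ℚ)) (2 ^ (n + 2))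
  obtain ⟨-, hn2⟩ := norm_one_add_eq_and_norm_two_add_eq hκ v hv hn hζ
  set y : F := ⟨ζ + ζ⁻¹, add_inv_mem_fixedField_localSubgroup_layerSubgroup hκ v n hζ.pow_eq_one⟩ with hy
  have hy0 : (2 + y : F) ≠ 0 := by
    intro h0
    rw [h0, Algebra.norm_zero] at hn2
    exact two_ne_zero hn2.symm
  exact ⟨Units.map (Algebra.norm (v.adicCompletion ℚ) : F →* v.adicCompletion ℚ) (Units.mk0 _ hy0),
    ⟨Units.mk0 _ hy0, rfl⟩, by rw [Units.coe_map, Units.val_mk0]; exact hn2⟩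

/-- **`N_{F_n/ℚ_v}(ℓ) = ∏_{i<2^n} gⁱℓ`** for `ℓ ∈ F_n = K̄^{H_n}` and `g` a generator at the layer `0` (`κ(res g)` a unit):
the powers `gⁱ`, `i < 2^n`, represent `Γ/H_n` (BRICK 15), so BRICK 16 `algebraMap_norm_eq_prod_smul` applies.
[cite: NeukirchANT1999, Ch. IV §1] [cite: Washington1997, §13.1] -/
theorem algebraMap_norm_layer_eq_prod_pow_smul (hκ : κ.IsCyclotomic) (v : HeightOneSpectrum (𝓞 ℚ))
    (hv : ((2 : ℕ) : 𝓞 ℚ) ∈ v.asIdeal) (n : ℕ) {g : absoluteGaloisGroup (v.adicCompletion ℚ)} {u : ℤ_[2]ˣ}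
    (hu : ((κ (resGal (K := ℚ) (v.adicCompletion ℚ) g)).toAdd : ℤ_[2]) = 2 ^ 0 * (u : ℤ_[2]))
    (ℓ : IntermediateField.fixedField (localSubgroup (κ.layerSubgroup n) (v.adicCompletion ℚ))) :
    algebraMap (v.adicCompletion ℚ) (AlgebraicClosure (v.adicCompletion ℚ)) (Algebra.norm (v.adicCompletion ℚ) ℓ) =
      ∏ i ∈ Finset.range (2 ^ n), (g ^ i) • (ℓ : AlgebraicClosure (v.adicCompletion ℚ)) := by
  have hopen := isOpen_localSubgroup (κ.layerSubgroup n) (κ.isOpen_layerSubgroup n) (v.adicCompletion ℚ)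
  have hcov : ∀ σ : absoluteGaloisGroup (v.adicCompletion ℚ), ∃ k : Fin (2 ^ n),
      σ⁻¹ * g ^ (k : ℕ) ∈ localSubgroup (κ.layerSubgroup n) (v.adicCompletion ℚ) := by
    intro σ
    have hσ0 : σ ∈ localSubgroup (κ.layerSubgroup 0) (v.adicCompletion ℚ) := by
      rw [mem_localSubgroup_iff, ZpExtension.mem_layerSubgroup, pow_zero]
      exact one_dvd _
    obtain ⟨i, hi, hiσ⟩ := exists_pow_inv_mul_mem_localSubgroup_layerSubgroup (κ := κ) v 0 n hu hσ0
    rw [Nat.zero_add] at hiσ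
    refine ⟨⟨i, hi⟩, ?_⟩
    have h := Subgroup.inv_mem _ hiσ
    rwa [mul_inv_rev, inv_inv] at h
  haveI := finiteDimensional_fixedField_localSubgroup_layerSubgroup (κ := κ) v n
  haveI := isGalois_fixedField_localSubgroup_layerSubgroup (κ := κ) v n
  have hrank := finrank_fixedField_localSubgroup_layerSubgroup hκ v hv n
  have hcard : Fintype.card (Fin (2 ^ n)) = Module.finrank (v.adicCompletion ℚ)
      (IntermediateField.fixedField (localSubgroup (κ.layerSubgroup n) (v.adicCompletion ℚ))) := by
    rw [Fintype.card_fin, hrank]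
  haveI : CharZero (v.adicCompletion ℚ) :=
    charZero_of_injective_algebraMap (algebraMap ℚ (v.adicCompletion ℚ)).injective
  have hfix := fixingSubgroup_fixedField_of_isOpen _ hopen
  have hH := fun σ ↦ SetLike.ext_iff.mp hfix σ
  have hnorm := algebraMap_norm_eq_prod_smul v _ hH (fun k : Fin (2 ^ n) ↦ g ^ (k : ℕ)) hcov hcard ℓ
  exact hnorm.trans (Fin.prod_univ_eq_prod_range (fun i ↦ (g ^ i) • (ℓ : AlgebraicClosure (v.adicCompletion ℚ))) (2 ^ n))

/-! ### The unramified quadratic field `M = K̄^{Stab t} = ℚ_v(t)`: `N_{M/ℚ_v}(k) = k·τ₀k` -/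

/-- **`N_{ℚ_v(t)/ℚ_v}(k) = k·τ₀k`** for `k ∈ K̄^{Stab t}`, `t ≠ 0` with `σt = ±t` for all `σ`, and `τ₀` any element with
`τ₀t = −t`: `Stab(t)` is open, normal, of index `2`, its fixed field is Galois of degree `2` over `ℚ_v` with group
`{1, τ₀|}`. [cite: NeukirchANT1999, Ch. IV §1] -/
theorem algebraMap_norm_stabilizer_eq_mul_smul (v : HeightOneSpectrum (𝓞 ℚ))
    {t : AlgebraicClosure (v.adicCompletion ℚ)}
    (ht : ∀ σ : absoluteGaloisGroup (v.adicCompletion ℚ), σ • t = t ∨ σ • t = -t) (ht0 : t ≠ 0)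
    {τ₀ : absoluteGaloisGroup (v.adicCompletion ℚ)} (hτ₀t : τ₀ • t = -t)
    (k : IntermediateField.fixedField (MulAction.stabilizer (absoluteGaloisGroup (v.adicCompletion ℚ)) t)) :
    algebraMap (v.adicCompletion ℚ) (AlgebraicClosure (v.adicCompletion ℚ)) (Algebra.norm (v.adicCompletion ℚ) k) =
      (k : AlgebraicClosure (v.adicCompletion ℚ)) * τ₀ • (k : AlgebraicClosure (v.adicCompletion ℚ)) := by
  revert k
  set St : Subgroup (absoluteGaloisGroup (v.adicCompletion ℚ)) :=
    MulAction.stabilizer (absoluteGaloisGroup (v.adicCompletion ℚ)) t with hSt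
  have hopenSt : IsOpen (St : Set (absoluteGaloisGroup (v.adicCompletion ℚ))) := isOpen_stabilizer v t
  have hnormSt : St.Normal := stabilizer_normal v ht
  have hidxSt : St.index = 2 := by
    have h := relIndex_inf_stabilizer_eq_two v ht ht0 (H := ⊤) (Subgroup.mem_top τ₀) hτ₀t
    rwa [top_inf_eq, Subgroup.relIndex_top_right] at h
  have hne := neg_ne_self_of_ne_zero v ht0
  have memSt : ∀ {h : absoluteGaloisGroup (v.adicCompletion ℚ)}, h ∈ St ↔ h • t = t := fun {h} ↦ by
    rw [hSt, MulAction.mem_stabilizer_iff]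
  haveI : CharZero (v.adicCompletion ℚ) :=
    charZero_of_injective_algebraMap (algebraMap ℚ (v.adicCompletion ℚ)).injective
  set M₀ : IntermediateField (v.adicCompletion ℚ) (AlgebraicClosure (v.adicCompletion ℚ)) :=
    IntermediateField.fixedField St with hM₀
  intro k
  have htM : t ∈ M₀ := by
    rw [hM₀, IntermediateField.mem_fixedField_iff]
    exact fun σ hσ ↦ memSt.mp hσ
  haveI hfinM : FiniteDimensional (v.adicCompletion ℚ) M₀ := finiteDimensional_fixedField_of_isOpen St hopenSt
  have hrkM : Module.finrank (v.adicCompletion ℚ) M₀ = 2 := by rw [hM₀, finrank_fixedField_of_isOpen St hopenSt, hidxSt]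
  have hfixM := fixingSubgroup_fixedField_of_isOpen St hopenSt
  haveI hGalM : IsGalois (v.adicCompletion ℚ) M₀ := by
    have key := fun x ↦ SetLike.ext_iff.mp hfixM x
    refine (InfiniteGalois.normal_iff_isGalois _).mp ?_
    exact ⟨fun a ha b ↦ (key _).mpr (hnormSt.conj_mem a ((key a).mp ha) b)⟩
  let rτ : M₀ ≃ₐ[v.adicCompletion ℚ] M₀ := (absoluteGaloisGroup.toAlgEquiv (v.adicCompletion ℚ) τ₀).restrictNormal M₀
  have hrτ : ∀ x : M₀, ((rτ x : M₀) : AlgebraicClosure (v.adicCompletion ℚ)) =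
      τ₀ • (x : AlgebraicClosure (v.adicCompletion ℚ)) := fun x ↦ AlgEquiv.restrictNormal_commutes _ M₀ x
  have hrτ1 : rτ ≠ 1 := by
    intro h
    have h1 : ((rτ ⟨t, htM⟩ : M₀) : AlgebraicClosure (v.adicCompletion ℚ)) = τ₀ • t := hrτ ⟨t, htM⟩
    rw [h, AlgEquiv.one_apply, hτ₀t] at h1
    exact hne h1.symm
  have hcardM : Nat.card (M₀ ≃ₐ[v.adicCompletion ℚ] M₀) = 2 := by
    rw [IsGalois.card_aut_eq_finrank (v.adicCompletion ℚ) M₀, hrkM]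
  have hallM : ∀ σ : M₀ ≃ₐ[v.adicCompletion ℚ] M₀, σ = 1 ∨ σ = rτ := by
    intro σ
    by_contra hσ
    push Not at hσ
    letI : Fintype (M₀ ≃ₐ[v.adicCompletion ℚ] M₀) := Fintype.ofFinite _
    have h3 : ({σ, 1, rτ} : Finset (M₀ ≃ₐ[v.adicCompletion ℚ] M₀)).card = 3 := by
      rw [Finset.card_insert_of_notMem (by simp [hσ.1, hσ.2]), Finset.card_pair hrτ1.symm]
    have hle := Finset.card_le_univ ({σ, 1, rτ} : Finset (M₀ ≃ₐ[v.adicCompletion ℚ] M₀))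
    rw [h3, ← Nat.card_eq_fintype_card, hcardM] at hle
    omega
  have h := Algebra.norm_eq_prod_automorphisms (v.adicCompletion ℚ) k
  rw [Finset.prod_eq_mul 1 rτ hrτ1.symm (fun c _ hc ↦ ((hallM c).elim hc.1 hc.2).elim)
    (fun h1 ↦ (h1 (Finset.mem_univ _)).elim) (fun h1 ↦ (h1 (Finset.mem_univ _)).elim), AlgEquiv.one_apply] at h
  have h' : algebraMap (v.adicCompletion ℚ) (AlgebraicClosure (v.adicCompletion ℚ)) (Algebra.norm (v.adicCompletion ℚ) k) =
      ((k * rτ k : M₀) : AlgebraicClosure (v.adicCompletion ℚ)) := by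
    rw [IsScalarTower.algebraMap_apply (v.adicCompletion ℚ) M₀ (AlgebraicClosure (v.adicCompletion ℚ)), h]; rfl
  rw [h', MulMemClass.coe_mul, hrτ]

/-! ### The cyclic layer `F'_n = K̄^{H_n ∩ Stab t}` over `M`: norm index `2^n` and `N_{F'_n/M}(f) = ∏_{i<2^n} gⁱf` -/

/-- **`F'_n/M` is cyclic of degree `2^n`, generated by the restriction of `g`: `[Mˣ : N(F'_nˣ)] = 2^n` and
`N_{F'_n/M}(f) = ∏_{i<2^n} gⁱf`.** Here `M = K̄^{Stab t}`, `F'_n = K̄^{H_n ∩ Stab t}`, `τ₀ ∈ H_∞` a flip, `g` a generator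
at the layer `0` fixing `t` (`gⁱ ∈ H_n ⟺ 2^n ∣ i`, BRICK 15, so `g|_{F'_n}` has order `2^n = [F'_n : M]`); the index is the
tree's PROVED class field axiom `normIndex_eq_finrank_of_isNonarchimedeanLocalField` (Neukirch V (1.1)) for the cyclic
extension `F'_n/M` of the local field `M`. [cite: NeukirchANT1999, Ch. V §1 Thm. (1.1), Ch. IV §1] -/
theorem index_range_norm_relLayer_eq_and_norm_eq_prod_smul (hκ : κ.IsCyclotomic) (v : HeightOneSpectrum (𝓞 ℚ))
    (hv : ((2 : ℕ) : 𝓞 ℚ) ∈ v.asIdeal) (n : ℕ) {t : AlgebraicClosure (v.adicCompletion ℚ)}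
    (ht : ∀ σ : absoluteGaloisGroup (v.adicCompletion ℚ), σ • t = t ∨ σ • t = -t) (ht0 : t ≠ 0)
    {τ₀ : absoluteGaloisGroup (v.adicCompletion ℚ)} (hτ₀ : τ₀ ∈ localSubgroup κ.kerSubgroup (v.adicCompletion ℚ))
    (hτ₀t : τ₀ • t = -t) {g : absoluteGaloisGroup (v.adicCompletion ℚ)} {u : ℤ_[2]ˣ}
    (hu : ((κ (resGal (K := ℚ) (v.adicCompletion ℚ) g)).toAdd : ℤ_[2]) = 2 ^ 0 * (u : ℤ_[2])) (hgt : g • t = t)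
    (hML : (IntermediateField.fixedField (MulAction.stabilizer (absoluteGaloisGroup (v.adicCompletion ℚ)) t) :
        IntermediateField (v.adicCompletion ℚ) (AlgebraicClosure (v.adicCompletion ℚ))) ≤
      IntermediateField.fixedField (localSubgroup (κ.layerSubgroup n) (v.adicCompletion ℚ) ⊓
        MulAction.stabilizer (absoluteGaloisGroup (v.adicCompletion ℚ)) t)) :
    letI := LocalWeilDatum.towerAlgebra hML
    (Units.map (Algebra.norm
        (IntermediateField.fixedField (MulAction.stabilizer (absoluteGaloisGroup (v.adicCompletion ℚ)) t)) :
        IntermediateField.fixedField (localSubgroup (κ.layerSubgroup n) (v.adicCompletion ℚ) ⊓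
          MulAction.stabilizer (absoluteGaloisGroup (v.adicCompletion ℚ)) t) →*
        IntermediateField.fixedField (MulAction.stabilizer (absoluteGaloisGroup (v.adicCompletion ℚ)) t))).range.index =
        2 ^ n ∧
      ∀ f : IntermediateField.fixedField (localSubgroup (κ.layerSubgroup n) (v.adicCompletion ℚ) ⊓
          MulAction.stabilizer (absoluteGaloisGroup (v.adicCompletion ℚ)) t),
        ((Algebra.norm (IntermediateField.fixedField
            (MulAction.stabilizer (absoluteGaloisGroup (v.adicCompletion ℚ)) t)) f :
          IntermediateField.fixedField (MulAction.stabilizer (absoluteGaloisGroup (v.adicCompletion ℚ)) t)) :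
            AlgebraicClosure (v.adicCompletion ℚ)) =
          ∏ i ∈ Finset.range (2 ^ n), (g ^ i) • (f : AlgebraicClosure (v.adicCompletion ℚ)) := by
  /- the groups (all `localSubgroup` terms are built BEFORE `CharZero ℚ_v` enters the context) -/
  set Hn : Subgroup (absoluteGaloisGroup (v.adicCompletion ℚ)) := localSubgroup (κ.layerSubgroup n) (v.adicCompletion ℚ) with hHn
  have hopenHn : IsOpen (Hn : Set (absoluteGaloisGroup (v.adicCompletion ℚ))) :=
    isOpen_localSubgroup (κ.layerSubgroup n) (κ.isOpen_layerSubgroup n) (v.adicCompletion ℚ)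
  haveI hnormHn : Hn.Normal := by
    rw [hHn, localSubgroup_eq_comap]; exact Subgroup.Normal.comap inferInstance _
  have hidxHn : Hn.index = 2 ^ n := index_localSubgroup_layerSubgroup hκ v hv n
  have hτ₀n : τ₀ ∈ Hn := by
    rw [hHn, mem_localSubgroup_iff]
    rw [mem_localSubgroup_iff] at hτ₀
    exact κ.kerSubgroup_le_layerSubgroup n hτ₀
  set St : Subgroup (absoluteGaloisGroup (v.adicCompletion ℚ)) := MulAction.stabilizer (absoluteGaloisGroup (v.adicCompletion ℚ)) t with hSt
  have hopenSt : IsOpen (St : Set (absoluteGaloisGroup (v.adicCompletion ℚ))) := isOpen_stabilizer v t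
  have hnormSt : St.Normal := stabilizer_normal v ht
  have hidxSt : St.index = 2 := by
    have h := relIndex_inf_stabilizer_eq_two v ht ht0 (H := ⊤) (Subgroup.mem_top τ₀) hτ₀t
    rwa [top_inf_eq, Subgroup.relIndex_top_right] at h
  set D : Subgroup (absoluteGaloisGroup (v.adicCompletion ℚ)) := Hn ⊓ St with hD
  have hopenD : IsOpen (D : Set (absoluteGaloisGroup (v.adicCompletion ℚ))) := hopenHn.inter hopenSt
  have hnormD : D.Normal := by
    haveI := hnormHn
    haveI := hnormSt
    exact Subgroup.normal_inf_normal Hn St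
  have hDle : D ≤ Hn := inf_le_left
  have hrel : D.relIndex Hn = 2 := relIndex_inf_stabilizer_eq_two v ht ht0 hτ₀n hτ₀t
  have hidxD : D.index = 2 * 2 ^ n := by rw [← Subgroup.relIndex_mul_index hDle, hrel, hidxHn]
  have memD : ∀ {h : absoluteGaloisGroup (v.adicCompletion ℚ)}, h ∈ D ↔ h ∈ Hn ∧ h • t = t := fun {h} ↦ by
    rw [hD, Subgroup.mem_inf, hSt, MulAction.mem_stabilizer_iff]
  have memSt : ∀ {h : absoluteGaloisGroup (v.adicCompletion ℚ)}, h ∈ St ↔ h • t = t := fun {h} ↦ by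
    rw [hSt, MulAction.mem_stabilizer_iff]
  have hgpow : ∀ i : ℕ, g ^ i ∈ Hn ↔ 2 ^ n ∣ i := fun i ↦ by
    have h := pow_mem_localSubgroup_layerSubgroup_iff (κ := κ) v 0 n hu i
    rwa [zero_add] at h
  have hgpt : ∀ i : ℕ, (g ^ i) • t = t := fun i ↦ by
    induction i with
    | zero => rw [pow_zero, one_smul]
    | succ i ih => rw [pow_succ, mul_smul, hgt, ih]
  /- the fields -/
  haveI : CharZero (v.adicCompletion ℚ) :=
    charZero_of_injective_algebraMap (algebraMap ℚ (v.adicCompletion ℚ)).injective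
  set M₀ : IntermediateField (v.adicCompletion ℚ) (AlgebraicClosure (v.adicCompletion ℚ)) :=
    IntermediateField.fixedField St with hM₀
  set L₀ : IntermediateField (v.adicCompletion ℚ) (AlgebraicClosure (v.adicCompletion ℚ)) :=
    IntermediateField.fixedField D with hL₀
  have memM : ∀ {x : AlgebraicClosure (v.adicCompletion ℚ)}, x ∈ M₀ ↔
      ∀ σ : absoluteGaloisGroup (v.adicCompletion ℚ), σ • t = t → σ • x = x := fun {x} ↦ by
    rw [hM₀, IntermediateField.mem_fixedField_iff]
    exact ⟨fun H σ hσ ↦ H σ (memSt.mpr hσ), fun H σ hσ ↦ H σ (memSt.mp hσ)⟩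
  have memL : ∀ {x : AlgebraicClosure (v.adicCompletion ℚ)}, x ∈ L₀ ↔ ∀ h ∈ Hn, h • t = t → h • x = x := fun {x} ↦ by
    rw [hL₀, IntermediateField.mem_fixedField_iff]
    exact ⟨fun H h hh hht ↦ H h (memD.mpr ⟨hh, hht⟩), fun H h hh ↦ H h (memD.mp hh).1 (memD.mp hh).2⟩
  have hML' : M₀ ≤ L₀ := fun x hx ↦ memL.mpr fun h _ hht ↦ memM.mp hx h hht
  haveI hfinM : FiniteDimensional (v.adicCompletion ℚ) M₀ := finiteDimensional_fixedField_of_isOpen St hopenSt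
  haveI hfinL : FiniteDimensional (v.adicCompletion ℚ) L₀ := finiteDimensional_fixedField_of_isOpen D hopenD
  have hrkM : Module.finrank (v.adicCompletion ℚ) M₀ = 2 := by rw [hM₀, finrank_fixedField_of_isOpen St hopenSt, hidxSt]
  have hrkL : Module.finrank (v.adicCompletion ℚ) L₀ = 2 * 2 ^ n := by
    rw [hL₀, finrank_fixedField_of_isOpen D hopenD, hidxD]
  have hfixL := fixingSubgroup_fixedField_of_isOpen D hopenD
  haveI hGalL : IsGalois (v.adicCompletion ℚ) L₀ := by
    have key := fun x ↦ SetLike.ext_iff.mp hfixL x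
    refine (InfiniteGalois.normal_iff_isGalois _).mp ?_
    exact ⟨fun a ha b ↦ (key _).mpr (hnormD.conj_mem a ((key a).mp ha) b)⟩
  letI : Algebra M₀ L₀ := LocalWeilDatum.towerAlgebra hML'
  haveI : IsScalarTower (v.adicCompletion ℚ) M₀ L₀ := LocalWeilDatum.towerAlgebra_isScalarTower_bot hML'
  haveI hfinML : FiniteDimensional M₀ L₀ := LocalWeilDatum.towerAlgebra_finiteDimensional hML'
  haveI hGal : IsGalois M₀ L₀ := IsGalois.tower_top_of_isGalois (v.adicCompletion ℚ) M₀ L₀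
  haveI : Module.Free M₀ L₀ := Module.Free.of_divisionRing M₀ L₀
  have hrk : Module.finrank M₀ L₀ = 2 ^ n := by
    have h := Module.finrank_mul_finrank (v.adicCompletion ℚ) M₀ L₀
    rw [hrkM, hrkL] at h
    exact Nat.eq_of_mul_eq_mul_left two_pos h
  have hcardGal : Nat.card (L₀ ≃ₐ[M₀] L₀) = 2 ^ n := by rw [IsGalois.card_aut_eq_finrank M₀ L₀, hrk]
  /- the restriction `ḡ` of `g` has order `2^n` -/
  let r : L₀ ≃ₐ[v.adicCompletion ℚ] L₀ := (absoluteGaloisGroup.toAlgEquiv (v.adicCompletion ℚ) g).restrictNormal L₀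
  have hr : ∀ x : L₀, ((r x : L₀) : AlgebraicClosure (v.adicCompletion ℚ)) = g • (x : AlgebraicClosure (v.adicCompletion ℚ)) :=
    fun x ↦ AlgEquiv.restrictNormal_commutes _ L₀ x
  let gbar : L₀ ≃ₐ[M₀] L₀ := AlgEquiv.ofRingEquiv (f := r.toRingEquiv) (fun k ↦ by
    apply Subtype.ext
    change ((r (algebraMap M₀ L₀ k) : L₀) : AlgebraicClosure (v.adicCompletion ℚ)) =
      ((algebraMap M₀ L₀ k : L₀) : AlgebraicClosure (v.adicCompletion ℚ))
    rw [hr, LocalWeilDatum.towerAlgebra_algebraMap_apply hML']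
    exact memM.mp k.2 g hgt)
  have hgbar : ∀ x : L₀, ((gbar x : L₀) : AlgebraicClosure (v.adicCompletion ℚ)) =
      g • (x : AlgebraicClosure (v.adicCompletion ℚ)) := fun x ↦ by exact hr x
  have hgbarpow : ∀ (i : ℕ) (x : L₀), (((gbar ^ i) x : L₀) : AlgebraicClosure (v.adicCompletion ℚ)) =
      (g ^ i) • (x : AlgebraicClosure (v.adicCompletion ℚ)) := by
    intro i
    induction i with
    | zero => intro x; rw [pow_zero, pow_zero, one_smul, AlgEquiv.one_apply]
    | succ i ih => intro x; rw [pow_succ', pow_succ', AlgEquiv.mul_apply, hgbar, ih, mul_smul]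
  have keyL : ∀ σ : absoluteGaloisGroup (v.adicCompletion ℚ), σ ∈ L₀.fixingSubgroup ↔ σ ∈ D := fun σ ↦
    SetLike.ext_iff.mp hfixL σ
  have hgbarone : ∀ i : ℕ, gbar ^ i = 1 ↔ 2 ^ n ∣ i := by
    intro i
    rw [← hgpow i]
    constructor
    · intro h1
      have hfix : g ^ i ∈ D := by
        refine (keyL _).mp ((IntermediateField.mem_fixingSubgroup_iff _ _).mpr fun x hx ↦ ?_)
        have h2 := hgbarpow i ⟨x, hx⟩
        rw [h1, AlgEquiv.one_apply] at h2
        exact h2.symm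
      exact (memD.mp hfix).1
    · intro hmem
      have hfix : g ^ i ∈ L₀.fixingSubgroup := (keyL _).mpr (memD.mpr ⟨hmem, hgpt i⟩)
      ext x
      have h2 := hgbarpow i x
      rw [AlgEquiv.one_apply]
      change (((gbar ^ i) x : L₀) : AlgebraicClosure (v.adicCompletion ℚ)) = (x : AlgebraicClosure (v.adicCompletion ℚ))
      rw [h2]
      exact (IntermediateField.mem_fixingSubgroup_iff _ _).mp hfix x x.2
  have horder : orderOf gbar = 2 ^ n :=
    Nat.dvd_antisymm (orderOf_dvd_of_pow_eq_one ((hgbarone _).mpr dvd_rfl)) ((hgbarone _).mp (pow_orderOf_eq_one gbar))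
  haveI : IsCyclic (L₀ ≃ₐ[M₀] L₀) := isCyclic_of_orderOf_eq_card gbar (horder.trans hcardGal.symm)
  have hidx : (Units.map (Algebra.norm M₀ : L₀ →* M₀)).range.index = 2 ^ n := by
    rw [normIndex_eq_finrank_of_isNonarchimedeanLocalField (v.adicCompletion ℚ) M₀ L₀, hrk]
  /- `N_{F'_n/M}(f) = ∏_{i<2^n} gⁱ f` -/
  let Θ : Fin (2 ^ n) → (L₀ ≃ₐ[M₀] L₀) := fun i ↦ gbar ^ (i : ℕ)
  have hinj : Function.Injective Θ := by
    intro i j hij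
    apply Fin.ext
    exact pow_injOn_Iio_orderOf (Set.mem_Iio.mpr (i.2.trans_eq horder.symm))
      (Set.mem_Iio.mpr (j.2.trans_eq horder.symm)) hij
  have hbij : Function.Bijective Θ := by
    rw [Fintype.bijective_iff_injective_and_card]
    refine ⟨hinj, ?_⟩
    rw [Fintype.card_fin, ← Nat.card_eq_fintype_card, hcardGal]
  have hnormM' : ∀ f : L₀, ((Algebra.norm M₀ f : M₀) : AlgebraicClosure (v.adicCompletion ℚ)) =
      ∏ i ∈ Finset.range (2 ^ n), (g ^ i) • (f : AlgebraicClosure (v.adicCompletion ℚ)) := by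
    intro f
    have hprod := Algebra.norm_eq_prod_automorphisms M₀ (L := L₀) f
    have h1 : ((Algebra.norm M₀ f : M₀) : AlgebraicClosure (v.adicCompletion ℚ)) =
        ((algebraMap M₀ L₀ (Algebra.norm M₀ f) : L₀) : AlgebraicClosure (v.adicCompletion ℚ)) :=
      (LocalWeilDatum.towerAlgebra_algebraMap_apply hML' _).symm
    rw [h1, hprod, IntermediateField.coe_prod, ← hbij.prod_comp,
      ← Fin.prod_univ_eq_prod_range (fun i ↦ (g ^ i) • (f : AlgebraicClosure (v.adicCompletion ℚ))) (2 ^ n)]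
    exact Finset.prod_congr rfl fun i _ ↦ hgbarpow i f
  exact ⟨hidx, fun f ↦ hnormM' f⟩

end Summit.BirchSwinnertonDyer.BirchSwinnertonDyer.Theorems.MultTowerNS2LayerZero

end
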